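import Mathlib
import HarnessLib
import Summits.ValiantsHypothesis.ValiantsHypothesis.Theorems.KPlusLogSqLawWeakLiftingTowerGraftWronskianKFourAlternantConverse
import Summits.ValiantsHypothesis.ValiantsHypothesis.Theorems.KPlusLogSqLawWeakLiftingTowerGraftWronskianKFourSextic

/-!
# Tower graft line — THE ALTERNANT INEQUALITY HOLDS ON THE PROVED SUPPORT FAMILIES (explicit generalized-Vandermonde facts)

Helper file for LINE (B) `Cruxes/WeakLifting/Lines/tower_graft.lean` (crux `WeakLifting` = stmt-ValiantsHypothesis-19561), target (W-4).  NO stub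
is claimed.  By the converse `…KFourAlternantConverse.five_le_of_alternant_identity`, every support on which Conjecture W at `K = 4` is proved
yields an explicit inequation between products of `5 × 5` generalized Vandermonde determinants at EVERY five-point configuration
`0 < r₀ < ⋯ < r₄`.  For the two open-cell families of this hand (`…KFourConsecutiveScaled`, `…KFourSextic`):

* ★ `alternant_identity_ne_consecutive` — supports `(c, c+2h, c+3h, c+4h)`: `A₁A₄·w₁w₃ ≠ A₀A₅·w₂w₃ + A₂A₃·w₁w₂`;
* ★ `alternant_identity_ne_sextic` — supports `(c, c+3h, c+4h, c+5h)`: the same.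

(The mirror families lie on the other orientation, where the sorted pair sums are ordered differently; they are covered by reflection upstream.)
HONEST FRAMING: instances of the alternant law (`…WronskianAlternantLawDefs.AlternantLawFour` stays OPEN); nothing on S4/S4f/S5/S5ᴸ, TowerB,
`WeakLifting`, Conjecture B, `MatrixDescartes` (18050), `VP ≠ VNP`.  Def-free.  Seat: prover leafhand-val-kpluslogsqlaw-1 g12, `--supports
stmt-ValiantsHypothesis-19561 --as helper`.  [this work]
-/

-- `Summit.ValiantsHypothesis.ValiantsHypothesis.…` repeats a component by the D-0017 layout
-- (single-conjunct summit), which the `dupNamespace` linter flags; the name is mandated.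
set_option linter.dupNamespace false
set_option autoImplicit false

namespace Summit.ValiantsHypothesis.ValiantsHypothesis.Theorems.KPlusLogSqLaw.TowerGraft

open Polynomial Finset
open scoped BigOperators Polynomial
open Literature.LinearAlgebra.Matrix.GeneralizedVandermonde (genVandermonde)

namespace WronskianDevelopable

/-- pointwise converse: a support on which `Z₊(W) ≤ 4` is known (orientation `d₀ + d₃ < d₁ + d₂`) carries no alternant identity. [this work] -/
theorem alternant_identity_ne_of_card_le_four (d : Fin 4 → ℕ) (hd : StrictMono d) (hA : d 0 + d 3 < d 1 + d 2)
    (H : ∀ u v : Fin 4 → ℝ,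
      ((wronskian (∑ l, C (u l) * (X : ℝ[X]) ^ d l) (∑ l, C (v l) * (X : ℝ[X]) ^ d l)).roots.toFinset.filter
        (fun x => 0 < x)).card ≤ 4)
    (r : Fin 5 → ℝ) (hr : StrictMono r) (hr0 : ∀ m, 0 < r m) :
    (genVandermonde r ![d 0 + d 1, d 0 + d 3, d 1 + d 2, d 1 + d 3, d 2 + d 3]).det *
        (genVandermonde r ![d 0 + d 1, d 0 + d 2, d 0 + d 3, d 1 + d 2, d 2 + d 3]).det *
        ((((d 1 : ℝ) - d 0) * ((d 3 : ℝ) - d 2)) * (((d 3 : ℝ) - d 0) * ((d 2 : ℝ) - d 1))) ≠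
      (genVandermonde r ![d 0 + d 2, d 0 + d 3, d 1 + d 2, d 1 + d 3, d 2 + d 3]).det *
          (genVandermonde r ![d 0 + d 1, d 0 + d 2, d 0 + d 3, d 1 + d 2, d 1 + d 3]).det *
          ((((d 2 : ℝ) - d 0) * ((d 3 : ℝ) - d 1)) * (((d 3 : ℝ) - d 0) * ((d 2 : ℝ) - d 1))) +
        (genVandermonde r ![d 0 + d 1, d 0 + d 2, d 1 + d 2, d 1 + d 3, d 2 + d 3]).det *
          (genVandermonde r ![d 0 + d 1, d 0 + d 2, d 0 + d 3, d 1 + d 3, d 2 + d 3]).det *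
          ((((d 1 : ℝ) - d 0) * ((d 3 : ℝ) - d 2)) * (((d 2 : ℝ) - d 0) * ((d 3 : ℝ) - d 1))) := by
  intro hid
  obtain ⟨u, v, -, h5⟩ := five_le_of_alternant_identity r hr hr0 d hd hA hid
  have := H u v
  omega

/-- ★ **the alternant inequality on the supports `(c, c+2h, c+3h, c+4h)`** (`h ≥ 1`), at every five-point configuration. [this work] -/
theorem alternant_identity_ne_consecutive (c h : ℕ) (hh : 0 < h) (r : Fin 5 → ℝ) (hr : StrictMono r) (hr0 : ∀ m, 0 < r m) :
    let d : Fin 4 → ℕ := ![c, c + 2 * h, c + 3 * h, c + 4 * h]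
    (genVandermonde r ![d 0 + d 1, d 0 + d 3, d 1 + d 2, d 1 + d 3, d 2 + d 3]).det *
        (genVandermonde r ![d 0 + d 1, d 0 + d 2, d 0 + d 3, d 1 + d 2, d 2 + d 3]).det *
        ((((d 1 : ℝ) - d 0) * ((d 3 : ℝ) - d 2)) * (((d 3 : ℝ) - d 0) * ((d 2 : ℝ) - d 1))) ≠
      (genVandermonde r ![d 0 + d 2, d 0 + d 3, d 1 + d 2, d 1 + d 3, d 2 + d 3]).det *
          (genVandermonde r ![d 0 + d 1, d 0 + d 2, d 0 + d 3, d 1 + d 2, d 1 + d 3]).det *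
          ((((d 2 : ℝ) - d 0) * ((d 3 : ℝ) - d 1)) * (((d 3 : ℝ) - d 0) * ((d 2 : ℝ) - d 1))) +
        (genVandermonde r ![d 0 + d 1, d 0 + d 2, d 1 + d 2, d 1 + d 3, d 2 + d 3]).det *
          (genVandermonde r ![d 0 + d 1, d 0 + d 2, d 0 + d 3, d 1 + d 3, d 2 + d 3]).det *
          ((((d 1 : ℝ) - d 0) * ((d 3 : ℝ) - d 2)) * (((d 2 : ℝ) - d 0) * ((d 3 : ℝ) - d 1))) := by
  intro d
  have hd : StrictMono d := by
    refine Fin.strictMono_iff_lt_succ.mpr fun i => ?_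
    fin_cases i <;> simp [d] <;> omega
  have hA : d 0 + d 3 < d 1 + d 2 := by simp [d]; omega
  exact alternant_identity_ne_of_card_le_four d hd hA
    (fun u v => card_posRoots_wronskian_four_le_four_consecutive_scaled u v c h hh) r hr hr0

/-- ★ **the alternant inequality on the supports `(c, c+3h, c+4h, c+5h)`** (`h ≥ 1`), at every five-point configuration. [this work] -/
theorem alternant_identity_ne_sextic (c h : ℕ) (hh : 0 < h) (r : Fin 5 → ℝ) (hr : StrictMono r) (hr0 : ∀ m, 0 < r m) :
    let d : Fin 4 → ℕ := ![c, c + 3 * h, c + 4 * h, c + 5 * h]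
    (genVandermonde r ![d 0 + d 1, d 0 + d 3, d 1 + d 2, d 1 + d 3, d 2 + d 3]).det *
        (genVandermonde r ![d 0 + d 1, d 0 + d 2, d 0 + d 3, d 1 + d 2, d 2 + d 3]).det *
        ((((d 1 : ℝ) - d 0) * ((d 3 : ℝ) - d 2)) * (((d 3 : ℝ) - d 0) * ((d 2 : ℝ) - d 1))) ≠
      (genVandermonde r ![d 0 + d 2, d 0 + d 3, d 1 + d 2, d 1 + d 3, d 2 + d 3]).det *
          (genVandermonde r ![d 0 + d 1, d 0 + d 2, d 0 + d 3, d 1 + d 2, d 1 + d 3]).det *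
          ((((d 2 : ℝ) - d 0) * ((d 3 : ℝ) - d 1)) * (((d 3 : ℝ) - d 0) * ((d 2 : ℝ) - d 1))) +
        (genVandermonde r ![d 0 + d 1, d 0 + d 2, d 1 + d 2, d 1 + d 3, d 2 + d 3]).det *
          (genVandermonde r ![d 0 + d 1, d 0 + d 2, d 0 + d 3, d 1 + d 3, d 2 + d 3]).det *
          ((((d 1 : ℝ) - d 0) * ((d 3 : ℝ) - d 2)) * (((d 2 : ℝ) - d 0) * ((d 3 : ℝ) - d 1))) := by
  intro d
  have hd : StrictMono d := by
    refine Fin.strictMono_iff_lt_succ.mpr fun i => ?_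
    fin_cases i <;> simp [d] <;> omega
  have hA : d 0 + d 3 < d 1 + d 2 := by simp [d]; omega
  exact alternant_identity_ne_of_card_le_four d hd hA
    (fun u v => card_posRoots_wronskian_four_le_four_sextic_scaled u v c h hh) r hr hr0

end WronskianDevelopable

end Summit.ValiantsHypothesis.ValiantsHypothesis.Theorems.KPlusLogSqLaw.TowerGraft
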